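import Summits.Langlands.Langlands.Theses.FifteenLocusEisenstein

/-!
# `FifteenLocusEisenstein.SectorComplement` (stmt-Langlands-16058) — negative-side position lemmas

Refuter's kernel-checked bookkeeping (crux-attack vetting, 2026-08-17) for the route's declared
complement of the sector, `SectorComplement := Target → Langlands` (route FifteenLocusEisenstein,
crux rank 9, "THE REST OF THE MOUNTAIN … summit-strength modulo Target; closes only with the summit;
not where this route directs provers"; the rev-3 `Target` text — point-count modularity of every
non-CM integral Weierstrass model over the integers of an imaginary quadratic field — is inlined
verbatim in the item, and is definitionally the route decl `Target`). Nothing here asserts the item,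
the target or the summit; every conclusion is a negation or a truth table:

* `fifteenLocusEisenstein_not_sectorComplement_iff`: `¬ C ↔ Target ∧ ¬ Langlands` — a refutation of
  the item is EXACTLY a proof of the open sector theorem (modularity of all non-CM elliptic curves
  over all imaginary quadratic fields; Caraiani–Newton 2023 prove it when the residual image at `3`
  or `5` is large enough for their `3`–`5` switch (Thm 7.1), hence for every curve over those `F` with
  `X₀(15)(F)` finite (Thm 1.1) — the `5`-Borel locus is this route's sector) together with a
  refutation of the audited formal summit `_root_.Langlands`;
* (not restated — it is the homonymous lemma of the sibling frame
  `Theorems/SkinnerWilesDefectOneSectorComplement.lean` up to the route namespace, and `mt` of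
  `fun h _ ↦ h`): `¬ C → ¬ Langlands` — the item is implied by the summit (discard the hypothesis),
  so it is never stronger than the summit;
* `fifteenLocusEisenstein_sectorComplement_iff_langlands_of_target`: under `Target`, `C ↔ Langlands`;
* `fifteenLocusEisenstein_sectorComplement_iff_langlands_of_cruxes`: under the route's other five
  cruxes (`IrreducibleFiveModular`, `NonOrdinaryEisensteinModular`, `UnorientedOrdinaryModular`,
  `ReducibleOrdinaryModular`, `OrientedOrdinaryOfEngine`), `C ↔ Langlands` (`→` is the route's
  sorry-free deciding theorem `closes`) — once the route's own cruxes land, this item IS the summit;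
* `fifteenLocusEisenstein_sectorComplement_iff_not_or`: truth table `C ↔ ¬ Target ∨ Langlands` —
  provable only by proving the summit or refuting the target, refutable only in the world
  "target true, summit false".

The converse containment `Langlands → Target` (which would give the exact identity
`Langlands ↔ Target ∧ C`, available for the sibling frames of EisensteinGelfandKirillov and
DyadicOddResidue whose targets quantify over abstract de Rham `ρ`) is NOT derived here: it needs the
`ℓ`-adic Tate module of `E` as an irreducible framed Galois representation, de Rham above `ℓ` for
Fontaine's pinned datum and with Frobenius polynomial `X² − a_w(E)X + N w` a.e. (Hasse–Weil,
Serre/Faltings irreducibility for non-CM `E`, Fontaine–Faltings comparison) — objects deliberately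
kept out of this route's import cone (CONE REPAIR rev 3) and not all proved in the tree.
-/

set_option linter.dupNamespace false -- project-wide option; `Summit.Langlands.Langlands` is the mandated namespace

namespace Summit.Langlands.Langlands.Theorems

open Summit.Langlands.Langlands.Theses.FifteenLocusEisenstein

/-- Exact content of a refutation of the item: `¬ SectorComplement ↔ Target ∧ ¬ Langlands` — prove
the open sector theorem AND disprove the formal summit. [folklore] -/
theorem fifteenLocusEisenstein_not_sectorComplement_iff :
    ¬ SectorComplement ↔ Target ∧ ¬ _root_.Langlands :=
  Classical.not_imp

/-- Under the route TARGET (modularity of every non-CM elliptic curve over every imaginary quadratic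
field, point-count form) the item is literally the summit: `SectorComplement ↔ Langlands`.
[folklore] -/
theorem fifteenLocusEisenstein_sectorComplement_iff_langlands_of_target (hX : Target) :
    SectorComplement ↔ _root_.Langlands :=
  ⟨fun hC ↦ hC hX, fun h _ ↦ h⟩

/-- Under the other five hypotheses of the deciding theorem — the input `IrreducibleFiveModular`,
the two new cruxes `NonOrdinaryEisensteinModular` / `UnorientedOrdinaryModular`, the imported engine
`ReducibleOrdinaryModular` and the bookkeeping crux `OrientedOrdinaryOfEngine` — the item is
equivalent to the summit: `SectorComplement ↔ Langlands` (`→` is the route's sorry-free `closes`).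
So this item can close only together with the summit once the route's cruxes land. [folklore] -/
theorem fifteenLocusEisenstein_sectorComplement_iff_langlands_of_cruxes
    (h₁ : IrreducibleFiveModular) (h₃ : NonOrdinaryEisensteinModular)
    (h₂ : UnorientedOrdinaryModular) (hE : ReducibleOrdinaryModular)
    (h₄ : OrientedOrdinaryOfEngine) : SectorComplement ↔ _root_.Langlands :=
  ⟨fun hS ↦ closes h₁ h₃ h₂ hE h₄ hS, fun h _ ↦ h⟩

/-- Truth table of the item: `SectorComplement ↔ ¬ Target ∨ Langlands` — provable only by proving
the summit or refuting the target, refutable only in the world "target true, summit false".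
[folklore] -/
theorem fifteenLocusEisenstein_sectorComplement_iff_not_or :
    SectorComplement ↔ ¬ Target ∨ _root_.Langlands :=
  imp_iff_not_or

end Summit.Langlands.Langlands.Theorems
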